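import Summits.ABC.ABC.Theses.CuspFieldPencil
import Literature.Barriers.ABC.BakerMethodBounds

/-! Sanity (planner, stub-ideation k3 g3): quick proofs of the XS glue of `Sketch_g3.lean`
(Q3′ `goldenCuspShadow_of_goldenThird`, Q5d `sum_primeFactors_le_prod`, Q5e `two_not_dvd_Q`, Q3a `min_three_le_rpow`). -/

set_option linter.dupNamespace false

namespace Summit.ABC.ABC.Cruxes.GoldenCuspShadow.ConjugateK3G3.Sanity

open UniqueFactorizationMonoid Finset
open Summit.ABC.ABC.Theses.CuspFieldPencil

def GoldenThird : Prop :=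
  ∀ ε : ℝ, 0 < ε → ∃ κ : ℝ, ∀ u w : ℤ, IsCoprime u w → u * w * (u ^ 2 - 11 * u * w - w ^ 2) ≠ 0 →
    Real.log (max (|(u : ℝ)|) (|(w : ℝ)|)) ≤
      κ * (((radical (u * w * (u ^ 2 - 11 * u * w - w ^ 2))).natAbs : ℕ) : ℝ) ^ (1 / 3 + ε : ℝ)

/-- Q3′: `GoldenThird ⇒ GoldenCuspShadow`. -/
theorem goldenCuspShadow_of_goldenThird (h : GoldenThird) : GoldenCuspShadow := by
  intro ε hε
  obtain ⟨κ, hκ⟩ := h ε hε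
  refine ⟨max κ 0, fun u w hcop h0 => ?_⟩
  have h1 := hκ u w hcop h0
  have hR : (1 : ℝ) ≤ (((radical (u * w * (u ^ 2 - 11 * u * w - w ^ 2))).natAbs : ℕ) : ℝ) := by
    have : (radical (u * w * (u ^ 2 - 11 * u * w - w ^ 2))).natAbs ≠ 0 := by
      rw [Ne, Int.natAbs_eq_zero]; exact radical_ne_zero
    exact_mod_cast Nat.one_le_iff_ne_zero.mpr this
  have hR0 : (0 : ℝ) ≤ (((radical (u * w * (u ^ 2 - 11 * u * w - w ^ 2))).natAbs : ℕ) : ℝ) :=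
    zero_le_one.trans hR
  refine h1.trans ((mul_le_mul_of_nonneg_right (le_max_left κ 0) (Real.rpow_nonneg hR0 _)).trans ?_)
  exact mul_le_mul_of_nonneg_left (Real.rpow_le_rpow_of_exponent_le hR (by norm_num)) (le_max_right _ _)

/-- Q5d: `Σ_{p | n} p ≤ ∏_{p | n} p`. -/
theorem sum_primeFactors_le_prod (n : ℕ) :
    ∑ p ∈ n.primeFactors, (p : ℝ) ≤ ∏ p ∈ n.primeFactors, (p : ℝ) := by
  have key : ∀ s : Finset ℕ, (∀ p ∈ s, 2 ≤ p) → ∑ p ∈ s, (p : ℝ) ≤ ∏ p ∈ s, (p : ℝ) := by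
    intro s
    induction s using Finset.induction_on with
    | empty => intro _; simp
    | @insert a s ha ih =>
      intro hs
      have ha2 : (2 : ℝ) ≤ a := by exact_mod_cast hs a (mem_insert_self a s)
      have hs' : ∀ p ∈ s, 2 ≤ p := fun p hp => hs p (mem_insert_of_mem hp)
      rw [sum_insert ha, prod_insert ha]
      rcases s.eq_empty_or_nonempty with rfl | hne
      · simp
      · have hP : (2 : ℝ) ≤ ∏ p ∈ s, (p : ℝ) := by
          obtain ⟨q, hq⟩ := hne
          have hpos : 0 < ∏ p ∈ s, p := Finset.prod_pos fun i hi => by have := hs' i hi; omega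
          have hqle : q ≤ ∏ p ∈ s, p := Nat.le_of_dvd hpos (Finset.dvd_prod_of_mem _ hq)
          have h2 : (2 : ℕ) ≤ ∏ p ∈ s, p := (hs' q hq).trans hqle
          have h2' := (Nat.cast_le (α := ℝ)).mpr h2
          push_cast at h2'
          exact h2'
        have ih' := ih hs'
        nlinarith
  exact key _ fun p hp => (Nat.prime_of_mem_primeFactors hp).two_le

/-- Q5e: for coprime `u, w`, `Q = u² − 11uw − w²` is odd. -/
theorem two_not_dvd_Q (u w : ℤ) (hcop : IsCoprime u w) : ¬ (2 : ℤ) ∣ u ^ 2 - 11 * u * w - w ^ 2 := by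
  intro h
  have h2 : ¬ ((2 : ℤ) ∣ u ∧ (2 : ℤ) ∣ w) := by
    rintro ⟨hu, hw⟩
    obtain ⟨a, b, hab⟩ := hcop
    have : (2 : ℤ) ∣ 1 := by
      rw [← hab]; exact dvd_add (dvd_mul_of_dvd_right hu a) (dvd_mul_of_dvd_right hw b)
    norm_num at this
  have hQ : ((u ^ 2 - 11 * u * w - w ^ 2 : ℤ) : ZMod 2) = 0 :=
    (ZMod.intCast_zmod_eq_zero_iff_dvd _ 2).mpr h
  have hu' : ¬ ((u : ZMod 2) = 0 ∧ (w : ZMod 2) = 0) := by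
    rintro ⟨hu, hw⟩
    exact h2 ⟨(ZMod.intCast_zmod_eq_zero_iff_dvd u 2).mp hu, (ZMod.intCast_zmod_eq_zero_iff_dvd w 2).mp hw⟩
  push_cast at hQ
  generalize (u : ZMod 2) = a at hQ hu'
  generalize (w : ZMod 2) = b at hQ hu'
  revert a b
  decide

/-- Q3a: `min(a, b, c) ≤ (abc)^{1/3}`. -/
theorem min_three_le_rpow {a b c : ℝ} (ha : 0 ≤ a) (hb : 0 ≤ b) (hc : 0 ≤ c) :
    min (min a b) c ≤ (a * b * c) ^ (1 / 3 : ℝ) := by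
  set m := min (min a b) c with hm
  have hm0 : 0 ≤ m := le_min (le_min ha hb) hc
  have hma : m ≤ a := (min_le_left _ _).trans (min_le_left _ _)
  have hmb : m ≤ b := (min_le_left _ _).trans (min_le_right _ _)
  have hmc : m ≤ c := min_le_right _ _
  have h3 : m ^ (3 : ℕ) ≤ a * b * c := by
    calc m ^ (3 : ℕ) = m * m * m := by ring
      _ ≤ a * b * c := by
          apply mul_le_mul (mul_le_mul hma hmb hm0 ha) hmc hm0 (mul_nonneg ha hb)
  calc m = (m ^ (3 : ℕ)) ^ (1 / 3 : ℝ) := by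
          rw [← Real.rpow_natCast, ← Real.rpow_mul hm0]; norm_num
    _ ≤ (a * b * c) ^ (1 / 3 : ℝ) := Real.rpow_le_rpow (by positivity) h3 (by norm_num)

end Summit.ABC.ABC.Cruxes.GoldenCuspShadow.ConjugateK3G3.Sanity
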